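import Literature.MathematicalPhysics.QuantumManyBody.GroundStateFeynmanKacWitnessSymm
import Literature.MathematicalPhysics.QuantumManyBody.GroundStateFeynmanKacWitnessBoundary
import HarnessLib

/-!
# Ground state of the Feynman–Kac semigroup, XV: the ground state given the energy identity

Part of the proof of `GroundStateFeynmanKac` (Chung–Zhao (1995), Thm 3.17 with §8.3).  This file
assembles the Feynman–Kac side: for a measurable bounded pair profile `v`, `L > 0`, IF the
variational ground-state energy equals the top of the spectrum of the semigroup,

  `groundStateEnergy v N L = ENNReal.ofReal (−log ‖e^{−H_N}‖_{L²(Λ) → L²(Λ)})`   (hypothesis `hE`),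

THEN the continuous representative `φ₀ = μ₀⁻¹ T_1 e⁺` of the Perron–Frobenius eigenvector is a
ground state in the sense of `IsGroundStateFK` (measurable, `≥ 0`, Dirichlet, Bose symmetric,
normalised, eigen-relation and ground-state projection EVERYWHERE), is continuous on `(ℝ³)^N` and
strictly positive on the open box: `exists_isGroundStateFK_of_energy_eq`.  The energy identity
itself (Chung–Zhao Thm 3.27 / Prop 3.29 (81): the generator is `Δ − V` with Dirichlet conditions
and the top of its spectrum is the variational supremum over `C_c^∞`) is the remaining input.

## References

* K. L. Chung, Z. Zhao, *From Brownian Motion to Schrödinger's Equation* (1995), Thm 3.17,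
  Thm 3.27, Prop 3.29. [cite: ChungZhao1995, Thm 3.17]
-/

noncomputable section

namespace Literature.MathematicalPhysics.QuantumManyBody.BoseGas

open MeasureTheory ProbabilityTheory Filter Set
open scoped ENNReal NNReal Topology InnerProductSpace

variable {N : ℕ}

/-- `0 < μ₀ = ‖T_1‖ ≤ 1`, hence `λ₀ = −log μ₀ ≥ 0`, `μ₀^T = e^{−λ₀T}`. [folklore] -/
theorem rpow_norm_fkL2_eq_exp {v : ℝ → ℝ≥0∞} {L : ℝ} (hT1 : fkL2 (N := N) v L 1 ≠ 0) (T : ℝ) :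
    ‖fkL2 (N := N) v L 1‖ ^ T = Real.exp (-(-Real.log ‖fkL2 (N := N) v L 1‖ * T)) := by
  rw [Real.rpow_def_of_pos (norm_pos_iff.2 hT1)]
  ring_nf

/-- **The Feynman–Kac ground state, given the energy identity.** For measurable bounded `v`,
`L > 0` and `groundStateEnergy v N L = ofReal (−log ‖T_1‖)`, the continuous Perron–Frobenius
representative `φ₀` satisfies `IsGroundStateFK v L φ₀`, is continuous, and is strictly positive
on the open box. [cite: ChungZhao1995, Thm 3.17] -/
theorem exists_isGroundStateFK_of_energy_eq {v : ℝ → ℝ≥0∞} (hv : Measurable v) {C : ℝ≥0}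
    (hC : ∀ r, v r ≤ C) {L : ℝ} (hL : 0 < L)
    (hE : groundStateEnergy v N L = ENNReal.ofReal (-Real.log ‖fkL2 (N := N) v L 1‖)) :
    ∃ Ψ₀ : Config N → ℝ, IsGroundStateFK v L Ψ₀ ∧ Continuous Ψ₀ ∧ ∀ X ∈ boxN N L, 0 < Ψ₀ X := by
  obtain ⟨hT1, e, he1, he0, hTe, -, hsimple⟩ := fkL2_perronFrobenius (N := N) hv hC hL one_pos
  set μ₀ : ℝ := ‖fkL2 (N := N) v L 1‖ with hμ₀def
  have hμ₀ : 0 < μ₀ := norm_pos_iff.2 hT1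
  have hμ₀1 : μ₀ ≤ 1 := norm_fkL2_le_one v L 1
  set lam : ℝ := -Real.log μ₀ with hlam
  have hlam0 : 0 ≤ lam := by
    rw [hlam, neg_nonneg]
    exact Real.log_nonpos hμ₀.le hμ₀1
  have hEreal : (groundStateEnergy v N L).toReal = lam := by
    rw [hE, ENNReal.toReal_ofReal hlam0]
  set φ : Config N → ℝ := fun X => μ₀⁻¹ * fkReal v L 1 (fun Y => max ((e : Config N → ℝ) Y) 0) X
    with hφ
  refine ⟨φ, ⟨measurable_gs hv hφ, gs_nonneg hμ₀.le hφ, fun X hX => gs_of_notMem hφ hX,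
    fun σ X => gs_comp_perm hv hT1 he1 he0 hTe hsimple hφ σ X,
    lintegral_gs_sq hv he1 he0 hμ₀ hTe hφ, by rw [hE]; exact ENNReal.ofReal_ne_top,
    fun T hT X => ?_, fun g hg hg2 X => ?_⟩, continuous_gs hv hC hμ₀ hφ,
    fun X hX => gs_pos hv hC he1 he0 hμ₀ hφ hX⟩
  · rw [hEreal, fkSemigroup_gs hv hT1 he1 he0 hTe hsimple hφ hT X, rpow_norm_fkL2_eq_exp hT1]
  · have h := tendsto_fkSemigroup_gs hv hC hL hT1 he1 he0 hTe hsimple hφ hg hg2 X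
    rw [hEreal]
    refine h.congr' (Eventually.of_forall fun T => ?_)
    rw [show (-T : ℝ) = -1 * T by ring, Real.rpow_def_of_pos hμ₀]
    congr 2
    simp only [hlam]
    ring

end Literature.MathematicalPhysics.QuantumManyBody.BoseGas
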